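import Summits.RiemannHypothesis.RiemannHypothesis.Theorems.Splittings.JensenLaguerreFactorial
import HarnessLib

/-!
# THE JENSEN EDGE LAW IN THE POLYNOMIAL WORLD (LINE L4, part C: the ledger items) — cell `rh-split`, seat rh-split-jen-neg g14

HONEST LABEL: «SPLITTING SEARCH over kernel-typed RH-EQUIVALENCES; a splitting A ∧ B ⟹ RH is CONDITIONAL
bookkeeping unless A and B are both proved; nothing here bears on the truth of RH.»  Everything in this file is
RH-FREE real-polynomial analysis (class level); no statement mentions ξ or RH.

The four typed items of LINE L4 «JENSEN EDGE LAW» on route `EarlyAppointments` (D-0145; registered by verb (ii), lead RULING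
#257(d)), stated with their VERBATIM ledger signatures (`N` inlined as `natDegree − card roots`, data `γ_k = k!·P_k` inlined):

* `jensenCountMonoDegree`  = stmt-RiemannHypothesis-22161 `EarlyAppointments.JensenCountMonoDegree` (T1, all real data);
* `jensenEdgeUpperPoly`    = stmt-RiemannHypothesis-22162 `EarlyAppointments.JensenEdgeUpperPoly` (crux r6);
* `jensenEdgeLowerPoly`    = stmt-RiemannHypothesis-22166 `EarlyAppointments.JensenEdgeLowerPoly` (crux r7);
* `jensenEdgeLawPoly`      = stmt-RiemannHypothesis-22167 `EarlyAppointments.JensenEdgeLawPoly`: for every real polynomial `P`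
  with positive coefficients and every `n`, for all large `d`, `N(J^{d,n}_{k!P_k}) = N(P⁽ⁿ⁾)` — the row carries exactly the
  non-real zero count of `P⁽ⁿ⁾` (the positivity hypothesis is part of the filed signature and is not used by the proofs).

This is theory-2's law (rh-splitx-theory-2, PRED fa351ad19bfd000d §1: «row j non-hyperbolic at every large d ⟺ F⁽ʲ⁾ has a
non-real zero») made a THEOREM for polynomial worlds; the entire (Laguerre–Pólya*) form is item 22178 (informal, open).
-/

noncomputable section

set_option linter.dupNamespace false

namespace Summit.RiemannHypothesis.RiemannHypothesis.Theorems.Splittings.JensenEdgeLawPoly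

open Polynomial
open Literature.NumberTheory.LFunctions
open Literature.Analysis.Complex
open Summit.RiemannHypothesis.RiemannHypothesis.Theorems.Splittings.JensenCountMonotonicity
open Summit.RiemannHypothesis.RiemannHypothesis.Theorems.Splittings.JensenLaguerreFactorial

/-- **stmt-RiemannHypothesis-22161 `JensenCountMonoDegree` (proved):** `N(J^{d,n}_γ) ≤ N(J^{d+1,n}_γ)` for every real `γ`. -/
theorem jensenCountMonoDegree :
    ∀ (γ : ℕ → ℝ) (d n : ℕ), (Literature.NumberTheory.LFunctions.jensenPoly γ d n).natDegree - Multiset.card (Literature.NumberTheory.LFunctions.jensenPoly γ d n).roots ≤ (Literature.NumberTheory.LFunctions.jensenPoly γ (d + 1) n).natDegree - Multiset.card (Literature.NumberTheory.LFunctions.jensenPoly γ (d + 1) n).roots := by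
  intro γ d n
  exact nonrealRootCount_jensenPoly_succ_le γ d n

/-- **stmt-RiemannHypothesis-22162 `JensenEdgeUpperPoly` (proved):** `N(J^{d,n}) ≤ N(P⁽ⁿ⁾)` for all `d` (UPPER half). -/
theorem jensenEdgeUpperPoly :
    ∀ (P : Polynomial ℝ), (∀ k ≤ P.natDegree, 0 < P.coeff k) → ∀ (d n : ℕ), (Literature.NumberTheory.LFunctions.jensenPoly (fun k => ((k.factorial : ℕ) : ℝ) * P.coeff k) d n).natDegree - Multiset.card (Literature.NumberTheory.LFunctions.jensenPoly (fun k => ((k.factorial : ℕ) : ℝ) * P.coeff k) d n).roots ≤ (Polynomial.derivative^[n] P).natDegree - Multiset.card (Polynomial.derivative^[n] P).roots := by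
  intro P _ d n
  exact nonrealRootCount_jensenPoly_dataOf_le P d n

/-- **stmt-RiemannHypothesis-22166 `JensenEdgeLowerPoly` (proved):** eventually `N(P⁽ⁿ⁾) ≤ N(J^{d,n})` (LOWER half). -/
theorem jensenEdgeLowerPoly :
    ∀ (P : Polynomial ℝ), (∀ k ≤ P.natDegree, 0 < P.coeff k) → ∀ (n : ℕ), ∃ d₀ : ℕ, ∀ d ≥ d₀, (Polynomial.derivative^[n] P).natDegree - Multiset.card (Polynomial.derivative^[n] P).roots ≤ (Literature.NumberTheory.LFunctions.jensenPoly (fun k => ((k.factorial : ℕ) : ℝ) * P.coeff k) d n).natDegree - Multiset.card (Literature.NumberTheory.LFunctions.jensenPoly (fun k => ((k.factorial : ℕ) : ℝ) * P.coeff k) d n).roots := by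
  intro P _ n
  exact nonrealRootCount_iterate_derivative_le_eventually P n

/-- **stmt-RiemannHypothesis-22167 `JensenEdgeLawPoly` (proved): the EDGE LAW** — for all large `d`, `N(J^{d,n}) = N(P⁽ⁿ⁾)`. -/
theorem jensenEdgeLawPoly :
    ∀ (P : Polynomial ℝ), (∀ k ≤ P.natDegree, 0 < P.coeff k) → ∀ (n : ℕ), ∃ d₀ : ℕ, ∀ d ≥ d₀, (Literature.NumberTheory.LFunctions.jensenPoly (fun k => ((k.factorial : ℕ) : ℝ) * P.coeff k) d n).natDegree - Multiset.card (Literature.NumberTheory.LFunctions.jensenPoly (fun k => ((k.factorial : ℕ) : ℝ) * P.coeff k) d n).roots = (Polynomial.derivative^[n] P).natDegree - Multiset.card (Polynomial.derivative^[n] P).roots := by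
  intro P hP n
  obtain ⟨d₀, hd₀⟩ := jensenEdgeLowerPoly P hP n
  exact ⟨d₀, fun d hd => le_antisymm (jensenEdgeUpperPoly P hP d n) (hd₀ d hd)⟩

end Summit.RiemannHypothesis.RiemannHypothesis.Theorems.Splittings.JensenEdgeLawPoly

end
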